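import Mathlib
import Summits.CriticalPhenomena.Ising3DConformalLimit.Theses.HyperoctahedralRP

/-!
# Sketch — crux-ideate stmt-CriticalPhenomena-1980 (LimitRotationInvariant), ideator 2, round 1

First lemmas of the two levers (they only need to ELABORATE; no proofs):

* `QuarterTurnLiouville`  — pure complex analysis engine of card `quarter-turn-liouville`:
  an entire, π/2-periodic function of exponential type < 4 is constant.
* `AxialRotationS4`       — the crux-facing first target of that card: under the crux hypotheses
  (and HRP2Rigidity), S 4 is invariant under rotations of one point about a coordinate-axis line
  carrying the other three.
* `HalfPlaneCross`        — pure complex analysis engine of card `bisector-cross-light-cone`: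
  Siciak's cross theorem for two half-planes with the interior real rays as the cross sets,
  hull `{ |arg| + |arg| < π/2 }`.
* `InPlaneLightCone`      — the crux-facing output of that card: the two-cluster functions of the
  limit along a lattice axis extend to the complex strip of width (time gap − const): the
  speed-1 in-plane light cone of ModularBoosts (L)(b), with v = 1.
* `OneParticleMajorant`   — the RKHS/one-particle Cauchy–Schwarz inequality with the round
  kernel that (A) supplies.
-/

namespace Summit.CriticalPhenomena.Ising3DConformalLimit.Cruxes.LimitRotationInvariant.Sketch

open scoped BigOperators Real
open Literature.Probability.LatticeModels
open Summit.CriticalPhenomena.Ising3DConformalLimit.Theses.HyperoctahedralRP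

local notation "E³" => EuclideanSpace ℝ (Fin 3)

/-- Quarter-turn Liouville: an entire function with period π/2 and exponential type `a < 4`
along the imaginary direction is constant (its Fourier modes are `e^{4ikζ}`, and type `< 4`
kills every `k ≠ 0`; Boas, Entire Functions, §6.10 / periodic entire functions). -/
def QuarterTurnLiouville : Prop :=
  ∀ (f : ℂ → ℂ), Differentiable ℂ f →
    (∀ z : ℂ, f (z + ((Real.pi / 2 : ℝ) : ℂ)) = f z) →
    (∃ C a : ℝ, a < 4 ∧ ∀ z : ℂ, ‖f z‖ ≤ C * Real.exp (a * |z.im|)) →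
    ∀ z w : ℂ, f z = f w

/-- The hypotheses of the crux on a candidate limit `S` (verbatim from `LimitRotationInvariant`). -/
def CruxHyp (ρ : ℝ → ℝ) (Δ : ℝ) (S : CorrFamily 3) : Prop :=
  (∀ δ ∈ Set.Ioc (0:ℝ) 1, 0 < ρ δ) ∧ HasPointwiseScalingLimit (criticalCorr 3) ρ S ∧
  (∀ n z, z ∉ NonCoincident 3 n → S n z = 0) ∧ IsNondegenerateTwoPoint S ∧
  IsTranslationInvariant S ∧ IsScaleCovariant Δ S

/-- AXIAL ROTATION LEMMA for the four-point function (first milestone of `quarter-turn-liouville`):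
assuming (A) = `HRP2Rigidity`, for every limit `S` as in the crux, every linear isometry `R` fixing
the axis vector `e₂ := EuclideanSpace.single 2 1`, every point `x` and heights `h₁ h₂ h₃`, the value
`S 4 (R x, h₁e₂, h₂e₂, h₃e₂)` equals `S 4 (x, h₁e₂, h₂e₂, h₃e₂)`: one point may be rotated freely about a
coordinate axis carrying the other three.  Mechanism: ζ ↦ S 4 (R_ζ x, Y) is entire (one-particle
tube from (A) in the four frames ⊥ e₂), π/2-periodic (lattice quarter turn), of exponential type
≤ 3Δ ≤ 3 < 4 (RP norms + Newman's Gaussian bound), hence constant by `QuarterTurnLiouville`. -/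
def AxialRotationS4 : Prop :=
  HRP2Rigidity → ∀ (ρ : ℝ → ℝ) (Δ : ℝ) (S : CorrFamily 3), CruxHyp ρ Δ S →
    ∀ (R : E³ ≃ₗᵢ[ℝ] E³), R (EuclideanSpace.single 2 1) = EuclideanSpace.single 2 1 →
    ∀ (x : E³) (h₁ h₂ h₃ : ℝ),
      S 4 ![R x, h₁ • EuclideanSpace.single 2 1, h₂ • EuclideanSpace.single 2 1,
            h₃ • EuclideanSpace.single 2 1]
        = S 4 ![x, h₁ • EuclideanSpace.single 2 1, h₂ • EuclideanSpace.single 2 1,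
            h₃ • EuclideanSpace.single 2 1]

/-- Siciak's cross theorem, half-plane/ray instance (engine of `bisector-cross-light-cone`):
a function of two real variables on the quadrant `(a,∞) × (b,∞)` that is, for each fixed second
variable, the restriction of a function holomorphic on the half-plane `{Re u > a}` and, for each
fixed first variable, of one holomorphic on `{Re v > b}`, is the restriction of ONE function
holomorphic on the hull `{ |arg (u−a)| + |arg (v−b)| < π/2 }` (relative extremal function of the
interior ray in a half-plane = (2/π)|arg|; Jarnicki–Pflug 2011, cross theorem). -/
def HalfPlaneCross : Prop :=
  ∀ (F : ℝ → ℝ → ℂ) (a b : ℝ),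
    (∀ v : ℝ, b < v → ∃ G : ℂ → ℂ, DifferentiableOn ℂ G {u : ℂ | a < u.re} ∧
        ∀ u : ℝ, a < u → G (u : ℂ) = F u v) →
    (∀ u : ℝ, a < u → ∃ G : ℂ → ℂ, DifferentiableOn ℂ G {v : ℂ | b < v.re} ∧
        ∀ v : ℝ, b < v → G (v : ℂ) = F u v) →
    ∃ H : ℂ × ℂ → ℂ,
      DifferentiableOn ℂ H {p : ℂ × ℂ | a < p.1.re ∧ b < p.2.re ∧
        |Complex.arg (p.1 - a)| + |Complex.arg (p.2 - b)| < Real.pi / 2} ∧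
      ∀ u v : ℝ, a < u → b < v → H ((u : ℂ), (v : ℂ)) = F u v

/-- Reflection in the coordinate plane `x₀ = 0` (frame e₀) on `ℝ³`. -/
noncomputable def θ₀ : E³ → E³ := fun x => ((ℝ ∙ (EuclideanSpace.single 0 (1:ℝ) : E³))ᗮ).reflection x

/-- IN-PLANE LIGHT CONE, speed 1 (output of `bisector-cross-light-cone`, = ModularBoosts (L)(b)
with v = 1 in lattice directions): for every limit `S` as in the crux, every finite configuration
`A` in the open half-space `{x₀ > 0}` there is a constant `C` such that for every time gap
`t > C` the transverse slice `y ↦ S (m+m) (θ₀A, A + t e₀ + y e₁)` is the restriction to `ℝ` of a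
function holomorphic on the strip `|Im y| < t − C`.  (No (A) needed: RP in the B₂ arrangement
{e₀, e₁, (e₀±e₁)/√2} + Siciak's cross theorem + Lukacs' strip theorem for positive-definite
functions.) -/
def InPlaneLightCone : Prop :=
  ∀ (ρ : ℝ → ℝ) (Δ : ℝ) (S : CorrFamily 3), CruxHyp ρ Δ S →
    ∀ (m : ℕ) (A : Fin m → E³), (∀ i, 0 < A i 0) →
      ∃ C : ℝ, ∀ t : ℝ, C < t →
        ∃ g : ℂ → ℂ, DifferentiableOn ℂ g {z : ℂ | |z.im| < t - C} ∧
          ∀ y : ℝ, g (y : ℂ) =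
            S (m + m) (Fin.append (fun i => θ₀ (A i))
              (fun i => A i + t • EuclideanSpace.single 0 1 + y • EuclideanSpace.single 1 1))

/-- ONE-PARTICLE MAJORANT (the RKHS form in which (A) enters both cards): for a limit `S` as in
the crux with ROUND two-point function `S 2 (0,x) = c‖x‖^(−2Δ)` (the conclusion of
TwoPointKernelOfLimit ∘ HRP2Rigidity), RP in frame e₀ gives the Cauchy–Schwarz bound of the
(1+m)-point function seen from one separated point by the round kernel at the doubled point times
the doubled m-cluster: `S(1+m)(θ₀x, Y)² ≤ c (2x₀)^(−2Δ) · S(m+m)(θ₀Y, Y)` for `x`, `Y` in the open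
half-space. -/
def OneParticleMajorant : Prop :=
  ∀ (ρ : ℝ → ℝ) (Δ : ℝ) (S : CorrFamily 3), CruxHyp ρ Δ S →
    ∀ c : ℝ, (∀ x : E³, x ≠ 0 → S 2 ![0, x] = c * ‖x‖ ^ (-(2 * Δ))) →
    ∀ (m : ℕ) (Y : Fin m → E³) (x : E³), (∀ i, 0 < Y i 0) → 0 < x 0 →
      (S (1 + m) (Fin.append ![θ₀ x] Y)) ^ 2
        ≤ c * (2 * x 0) ^ (-(2 * Δ)) * S (m + m) (Fin.append (fun i => θ₀ (Y i)) Y)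

end Summit.CriticalPhenomena.Ising3DConformalLimit.Cruxes.LimitRotationInvariant.Sketch
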